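import Summits.BirchSwinnertonDyer.BirchSwinnertonDyer.Theorems.GoldfeldAllTwistsTwoConverseTwinInertSevenSplitSymbolFamilies
import Summits.BirchSwinnertonDyer.BirchSwinnertonDyer.Theorems.GoldfeldAllTwistsTwoConverseTwinGenusDescentRankZero
import HarnessLib

set_option linter.dupNamespace false -- namespace `…BirchSwinnertonDyer.BirchSwinnertonDyer…` is the cell's (D-0017 nested layout)
set_option autoImplicit false

/-!
# Twin″ (item 19140), 7-INERT half: local lemmas at `∞`, `2`, `7` and an inert prime for the PARTNER twists
# `49a1^{(ℓ)}`, `49a1^{(aℓ)}` of the auxiliary-prime road (part 1 of the complementarity law in the kernel)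

Cell `bsd-goldfeld`, seat `bsd-goldfeld-s1p-c301` (prover, gen 13); `--supports stmt-BirchSwinnertonDyer-19140` (twin″)
as a HELPER; sequel of `…TwinInertSevenSplitSymbol[Families]` (the `ℓ`-adic dichotomy). For a prime `ℓ ≡ 5 (mod 8)`
split in `ℚ(√−7)` and an auxiliary prime `a ≡ 1 (mod 8)` with `(a/7) = −1`, `(a/ℓ) = −1`, this file supplies the
places `∞`, `2`, `7`, `a` and proves, for the models `E_M : y² = x³ + 21M x² + 112M² x ≅ 49a1^{(M)}` (`M > 0`,
`M ≡ 5 (mod 8)`, good reduction at `2`; `S(M) = twoIsogenySelmerGroup (21M) (112M²)`, `S'(M) = twoIsogenySelmerGroup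
(−42M) (−7M²)`):
* `σ(ℓ) = −1` ⇒ **`S(ℓ) ⊆ {1, 7}`, `S'(ℓ) ⊆ {1, −7}`** (`card ≤ 2` each): `Sel₂(49a1^{(ℓ)})` is minimal;
* `σ(ℓ) = +1` ⇒ **`S(aℓ) ⊆ {1, 7}`, `S'(aℓ) ⊆ {1, −7}`**: `Sel₂(49a1^{(aℓ)})` is minimal
— exactly one of the two partners of the auxiliary-prime road is `2`-minimal (memo `HOME/INERT7-AUXPRIME-HORIZON.md`
§2; certified numerically for all `ℓ < 6000` by kit j288158). Local inputs: `∞` kills `d < 0` in `S(M)` (the form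
`d u⁴ + 21M u²z² + d' z⁴`, `dd' = 112M²`, is NEGATIVE DEFINITE: `(21M)² < 4dd'`; seat c3's
`not_isSoluble_real_twoIsogenyQuartic_of_neg_of_sq_lt`, by name); `2` kills every even class of `S(M)`
(both `ℤ₂`-charts modulo `16`, `decide` in `ℤ/16`); `7` cuts `S'(M)` down to `{1, ℓ, −7, −7ℓ}` (+ `a`-classes)
(Zywina's `p ∥ a² − 4dd'` lemma for `7 ∤ d`, a chart lemma for `7 ∣ d`); the inert prime `a` kills every class
divisible by `a` (the reduced quartic has discriminant `−7ℓ²` resp. `7·(16ℓ)²` — non-residues mod `a`); `ℓ` = the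
split symbol (previous files). The RANK/`Ш` consequences (`rank = 0`, `Ш[2] = 0`, whence via Burungale–Tian's rank-`0`
`2`-converse `L(49a1^{(M)},1) ≠ 0` and via Burungale–Flach the exact `2`-adic valuation of `L^{alg}`) are NOT drawn here.

HONEST FRAMING: Selmer sets of two auxiliary GOOD-reduction twists; no statement about the cell's curves `49a1^{(−ℓ)}`
beyond what parts VIII/SplitSymbol give; no case of twin″/K12₂″ decided; BSD is not proved by any of this.

References: Silverman, *AEC* (2009), X.4.9 [SilvermanAEC2009]; Zywina, arXiv:2502.01957, Lemma 3.1 [Zywina2025].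
-/

noncomputable section

open scoped Classical

open WeierstrassCurve Literature.NumberTheory.EllipticCurves
open Literature.NumberTheory.EllipticCurves.Zywina2025 (exists_padicInt_of_isSoluble
  isSquare_zmod_of_isSoluble_padic)

namespace Summit.BirchSwinnertonDyer.BirchSwinnertonDyer.Theorems.GoldfeldGoodTwists

/-! ## §1. Local lemmas at `∞`, `2`, `7` and an inert prime -/

/-- The finite check behind the `2`-adic lemma: in `ℤ/16`, for `x ∈ {5, 13}` (`M mod 16`) and `y ∈ {2, 6, 10, 14}`
(`2d₁ mod 16`, `d₁` odd), neither `y + 21x T² + 8 T⁴` nor `8 + 21x T² + y T⁴` is a square. [folklore] -/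
private theorem zmod_sixteen_key : ∀ x y : ZMod 16, (x = 5 ∨ x = 13) → (y = 2 ∨ y = 6 ∨ y = 10 ∨ y = 14) →
    ∀ T S : ZMod 16, S ^ 2 ≠ y + 21 * x * T ^ 2 + 8 * T ^ 4 ∧ S ^ 2 ≠ 8 + 21 * x * T ^ 2 + y * T ^ 4 := by
  decide

/-- `M ≡ 5 (mod 8)` ⇒ `M mod 16 ∈ {5, 13}` in `ℤ/16`. [folklore] -/
private theorem zmod_sixteen_of_mod_eight {M : ℤ} (hM : M % 8 = 5) : (M : ZMod 16) = 5 ∨ (M : ZMod 16) = 13 := by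
  have h : M % ((16 : ℕ) : ℤ) = 5 ∨ M % ((16 : ℕ) : ℤ) = 13 := by omega
  rw [← ZMod.intCast_mod M 16]
  rcases h with h | h <;> rw [h] <;> decide

/-- `d₁` odd ⇒ `2d₁ mod 16 ∈ {2, 6, 10, 14}` in `ℤ/16`. [folklore] -/
private theorem zmod_sixteen_two_mul_odd {d₁ : ℤ} (hd : Odd d₁) :
    ((2 * d₁ : ℤ) : ZMod 16) = 2 ∨ ((2 * d₁ : ℤ) : ZMod 16) = 6 ∨ ((2 * d₁ : ℤ) : ZMod 16) = 10 ∨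
      ((2 * d₁ : ℤ) : ZMod 16) = 14 := by
  obtain ⟨k, rfl⟩ := hd
  have h : (2 * (2 * k + 1)) % ((16 : ℕ) : ℤ) = 2 ∨ (2 * (2 * k + 1)) % ((16 : ℕ) : ℤ) = 6 ∨
      (2 * (2 * k + 1)) % ((16 : ℕ) : ℤ) = 10 ∨ (2 * (2 * k + 1)) % ((16 : ℕ) : ℤ) = 14 := by omega
  rw [← ZMod.intCast_mod (2 * (2 * k + 1)) 16]
  rcases h with h | h | h | h <;> rw [h] <;> decide

/-- `e` odd ⇒ `8e ≡ 8 (mod 16)`. [folklore] -/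
private theorem zmod_sixteen_eight_mul_odd {e : ℤ} (he : Odd e) : ((8 * e : ℤ) : ZMod 16) = 8 := by
  obtain ⟨k, rfl⟩ := he
  have h : (8 * (2 * k + 1)) % ((16 : ℕ) : ℤ) = 8 := by omega
  rw [← ZMod.intCast_mod (8 * (2 * k + 1)) 16, h]; decide

/-- **`2`-adic lemma for positive twists `M ≡ 5 (mod 8)`.** For `d₁, e` odd the homogeneous space
`w² = 2d₁ u⁴ + 21M u²z² + 8e z⁴` (an even class `d = 2d₁` of `S(M)`, `d' = 8e`) has no non-trivial `ℚ₂`-point: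
both `ℤ₂`-charts are impossible modulo `16`. [cite: SilvermanAEC2009, Prop. X.4.9 and Example X.4.10] -/
theorem not_isSoluble_two_evenClass_of_mod_eight {M d₁ e : ℤ} (hM : M % 8 = 5) (hd : Odd d₁) (he : Odd e) :
    ¬ ((twoIsogenyQuartic (21 * M) (2 * d₁) (8 * e)).map (Int.castRingHom ℚ_[2])).IsSoluble := by
  haveI : Fact (Nat.Prime 2) := ⟨Nat.prime_two⟩
  intro h
  obtain ⟨f, f', hff, t, s, hs⟩ := exists_padicInt_of_isSoluble h
  have hx := zmod_sixteen_of_mod_eight hM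
  have hy := zmod_sixteen_two_mul_odd hd
  have hz := zmod_sixteen_eight_mul_odd he
  rcases hff with ⟨rfl, rfl⟩ | ⟨rfl, rfl⟩
  · have h2 := congrArg (PadicInt.toZModPow 4 : ℤ_[2] →+* ZMod (2 ^ 4)) hs
    simp only [map_pow, map_add, map_mul, map_intCast] at h2
    have h2' : (PadicInt.toZModPow 4 s : ZMod 16) ^ 2 = ((2 * d₁ : ℤ) : ZMod 16) +
        21 * (M : ZMod 16) * (PadicInt.toZModPow 4 t) ^ 2 + 8 * (PadicInt.toZModPow 4 t) ^ 4 := by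
      rw [← hz]; push_cast at h2 ⊢; linear_combination h2
    exact (zmod_sixteen_key _ _ hx hy _ _).1 h2'
  · have h2 := congrArg (PadicInt.toZModPow 4 : ℤ_[2] →+* ZMod (2 ^ 4)) hs
    simp only [map_pow, map_add, map_mul, map_intCast] at h2
    have h2' : (PadicInt.toZModPow 4 s : ZMod 16) ^ 2 = 8 +
        21 * (M : ZMod 16) * (PadicInt.toZModPow 4 t) ^ 2 + ((2 * d₁ : ℤ) : ZMod 16) * (PadicInt.toZModPow 4 t) ^ 4 := by
      rw [← hz]; push_cast at h2 ⊢; linear_combination h2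
    exact (zmod_sixteen_key _ _ hx hy _ _).2 h2'

/-- **Odd `p`, `p ∣ d` once, `p ∣ a`, `p ∤ d'`**: if `d = p d₂` with `p ∤ d₂` and `d'` is NOT a square mod `p`, then
`w² = d u⁴ + a u²z² + d' z⁴` has no non-trivial `ℚ_p`-point (chart `u = 1`: `s² ≡ d'` mod `p`; chart `z = 1`: `s² ≡ d' t⁴`,
and `p ∣ t` would give `p² ∣ p d₂`). Used at `p = 7` for the classes `7d₂` of `S'(M)`.
[cite: SilvermanAEC2009, Prop. X.4.9 and Example X.4.10] -/
theorem not_isSoluble_padic_of_dvd_of_not_isSquare {p : ℕ} [Fact p.Prime] {a d d' c d₂ : ℤ} (ha : a = p * c)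
    (hd : d = p * d₂) (hd₂ : ¬ (p : ℤ) ∣ d₂) (hns : ¬ IsSquare ((d' : ℤ) : ZMod p)) :
    ¬ ((twoIsogenyQuartic a d d').map (Int.castRingHom ℚ_[p])).IsSoluble := by
  have hpp : Prime (p : ℤ_[p]) := PadicInt.prime_p
  intro h
  obtain ⟨e, e', hee, t, s, hs⟩ := exists_padicInt_of_isSoluble h
  rcases hee with ⟨he, he'⟩ | ⟨he, he'⟩ <;> rw [he, he'] at hs
  · -- chart z = 1 : s² = d + a t² + d' t⁴ = p(d₂ + c t²) + d' t⁴
    by_cases ht : (p : ℤ_[p]) ∣ t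
    · obtain ⟨t₁, rfl⟩ := ht
      -- p ∣ s² ⇒ p ∣ s ⇒ d₂ = p(…) ⇒ p ∣ d₂
      have hs' : s ^ 2 = (p : ℤ_[p]) * ((d₂ : ℤ_[p]) + c * (p : ℤ_[p]) ^ 2 * t₁ ^ 2 +
          d' * (p : ℤ_[p]) ^ 3 * t₁ ^ 4) := by
        rw [hs, hd, ha]; push_cast; ring
      have h1 : (p : ℤ_[p]) ∣ s ^ 2 := ⟨_, hs'⟩
      obtain ⟨s₁, rfl⟩ := hpp.dvd_of_dvd_pow h1
      have h2 : (p : ℤ_[p]) * (s₁ ^ 2 - c * (p : ℤ_[p]) * t₁ ^ 2 - d' * (p : ℤ_[p]) ^ 2 * t₁ ^ 4) = d₂ :=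
        mul_left_cancel₀ hpp.ne_zero (by linear_combination hs')
      apply hd₂
      have h3 : (p : ℤ_[p]) ∣ (d₂ : ℤ_[p]) := ⟨_, h2.symm⟩
      have h4 : PadicInt.toZMod (d₂ : ℤ_[p]) = 0 := (padicInt_toZMod_eq_zero_iff_dvd _).mpr h3
      rw [map_intCast] at h4
      exact (ZMod.intCast_zmod_eq_zero_iff_dvd d₂ p).mp h4
    · have h0 := congrArg PadicInt.toZMod hs
      rw [hd, ha] at h0
      simp only [map_pow, map_add, map_mul, map_intCast, map_natCast, Int.cast_mul, Int.cast_natCast,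
        ZMod.natCast_self, zero_mul, zero_add] at h0
      have hT : PadicInt.toZMod t ≠ 0 := by rwa [Ne, padicInt_toZMod_eq_zero_iff_dvd]
      apply hns
      refine ⟨PadicInt.toZMod s / PadicInt.toZMod t ^ 2, ?_⟩
      have hT4 : PadicInt.toZMod t ^ 4 ≠ 0 := pow_ne_zero 4 hT
      field_simp
      linear_combination -h0
  · -- chart u = 1 : s² = d' + a t² + d t⁴ ≡ d' (mod p)
    have h0 := congrArg PadicInt.toZMod hs
    rw [hd, ha] at h0
    simp only [map_pow, map_add, map_mul, map_intCast, map_natCast, Int.cast_mul, Int.cast_natCast,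
      ZMod.natCast_self, zero_mul, add_zero] at h0
    exact hns ⟨PadicInt.toZMod s, by rw [← pow_two, h0]⟩

/-- **Inert prime, no roots.** In a field of characteristic `≠ 2`: if `c² − 4xy` is not a square then
`x + c τ² + y τ⁴` has no root. [folklore] -/
theorem forall_quartic_ne_zero_of_disc_not_isSquare {F : Type*} [Field F] {x c y : F}
    (h : ¬ IsSquare (c ^ 2 - 4 * x * y)) : ∀ τ : F, x + c * τ ^ 2 + y * τ ^ 4 ≠ 0 := by
  intro τ hτ
  exact h ⟨2 * y * τ ^ 2 + c, by linear_combination (-(4 * y)) * hτ⟩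

/-! ## §2. Arithmetic side conditions -/

section Arith

variable {l : ℕ} [Fact l.Prime]

/-- For `ℓ ≡ 5 (mod 8)`: `ℓ ∉ {2, 7}`, `ℓ % 4 = 1`. [folklore] -/
theorem prime_ne_two_ne_seven_of_mod_eight_five (hl8 : l % 8 = 5) : l ≠ 2 ∧ l ≠ 7 ∧ l % 4 = 1 := by
  refine ⟨?_, ?_, by omega⟩ <;> rintro rfl <;> norm_num at hl8

/-- For `ℓ ≡ 5 (mod 8)`: `2` is not a square mod `ℓ`. [folklore] -/
theorem not_isSquare_two_zmod_of_mod_eight_five (hl8 : l % 8 = 5) : ¬ IsSquare (2 : ZMod l) := by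
  have hl2 : l ≠ 2 := (prime_ne_two_ne_seven_of_mod_eight_five hl8).1
  have h := (legendreSym.eq_neg_one_iff l (a := 2)).mp (by
    rw [legendreSym.at_two hl2, ZMod.χ₈_nat_eq_if_mod_eight]
    simp [hl8, show l % 2 = 1 by omega])
  exact_mod_cast h

end Arith

/-! ## §3. The `7`-adic filter on `S'(M)` and the `a`-adic filter -/

section Seven

/-- **`7`-adic filter, `7 ∤ d`.** For `7 ∤ M`, a class `d` of `S'(M) = twoIsogenySelmerGroup (−42M) (−7M²)` with `7 ∤ d`
is a non-zero square modulo `7` (`(−42M)² − 4d d' = 1792M² = 2⁸·7·M²` is exactly divisible by `7`; Zywina's lemma).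
[cite: Zywina2025, Lemma 3.1] -/
theorem isSquare_zmod_seven_of_mem_selmer' {M d : ℤ} (hM7 : ¬ (7 : ℤ) ∣ M) (h7d : ¬ (7 : ℤ) ∣ d)
    (hd : d ∈ twoIsogenySelmerGroup (-42 * M) (-7 * M ^ 2)) : IsSquare ((d : ℤ) : ZMod 7) := by
  haveI : Fact (Nat.Prime 7) := ⟨by norm_num⟩
  have hM0 : M ≠ 0 := by rintro rfl; exact hM7 (dvd_zero 7)
  have hb : (-7 * M ^ 2 : ℤ) ≠ 0 := mul_ne_zero (by norm_num) (pow_ne_zero 2 hM0)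
  rw [mem_twoIsogenySelmerGroup_iff hb] at hd
  obtain ⟨hsqf, ⟨d', hdd'⟩, -, hpadic⟩ := hd
  have hdiv : (-7 * M ^ 2 : ℤ) / d = d' := by rw [hdd', Int.mul_ediv_cancel_left _ hsqf.ne_zero]
  rw [hdiv] at hpadic
  have h7 : Prime (7 : ℤ) := by norm_num
  have hB : (-42 * M) ^ 2 - 4 * d * d' = 7 * (256 * M ^ 2) := by linear_combination 4 * hdd'
  refine (isSquare_zmod_of_isSoluble_padic (p := 7) (by norm_num) (by exact_mod_cast h7d) ?_ ?_ (hpadic 7)).2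
  · exact ⟨256 * M ^ 2, by exact_mod_cast hB⟩
  · intro h49
    have h49' : (7 : ℤ) ^ 2 ∣ 7 * (256 * M ^ 2) := by rw [← hB]; exact_mod_cast h49
    rw [pow_two] at h49'
    have h' : (7 : ℤ) ∣ 256 * M ^ 2 := (mul_dvd_mul_iff_left (by norm_num : (7 : ℤ) ≠ 0)).mp h49'
    rcases h7.dvd_or_dvd h' with h | h
    · norm_num at h
    · exact hM7 (h7.dvd_of_dvd_pow h)

/-- **`7`-adic filter, `7 ∣ d`.** For `7 ∤ M`, if the class `7d₂` (`7 ∤ d₂`) lies in `S'(M)` then `−d₂` is a square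
modulo `7` (its partner `d' = −M²/d₂` must be a square mod `7`). [cite: SilvermanAEC2009, Prop. X.4.9 and Example X.4.10] -/
theorem isSquare_neg_zmod_seven_of_seven_mul_mem_selmer' {M d₂ : ℤ} (hM7 : ¬ (7 : ℤ) ∣ M) (h7d : ¬ (7 : ℤ) ∣ d₂)
    (hd : 7 * d₂ ∈ twoIsogenySelmerGroup (-42 * M) (-7 * M ^ 2)) : IsSquare ((-d₂ : ℤ) : ZMod 7) := by
  haveI : Fact (Nat.Prime 7) := ⟨by norm_num⟩
  have hM0 : M ≠ 0 := by rintro rfl; exact hM7 (dvd_zero 7)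
  have hb : (-7 * M ^ 2 : ℤ) ≠ 0 := mul_ne_zero (by norm_num) (pow_ne_zero 2 hM0)
  rw [mem_twoIsogenySelmerGroup_iff hb] at hd
  obtain ⟨hsqf, ⟨d', hdd'⟩, -, hpadic⟩ := hd
  have hdiv : (-7 * M ^ 2 : ℤ) / (7 * d₂) = d' := by rw [hdd', Int.mul_ediv_cancel_left _ hsqf.ne_zero]
  rw [hdiv] at hpadic
  -- d₂ d' = −M², so d' ≡ −M²/d₂ and [d'] = [−d₂] mod 7
  have hrel : d₂ * d' = -M ^ 2 :=
    mul_left_cancel₀ (by norm_num : (7 : ℤ) ≠ 0) (by linear_combination -hdd')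
  by_contra hns
  have hns' : ¬ IsSquare ((d' : ℤ) : ZMod 7) := by
    intro ⟨r, hr⟩
    apply hns
    have hrel' : ((d₂ : ℤ) : ZMod 7) * (d' : ZMod 7) = -(M : ZMod 7) ^ 2 := by
      exact_mod_cast congrArg (Int.cast : ℤ → ZMod 7) hrel
    have hr0 : r ≠ 0 := by
      rintro rfl
      have h0 : ((d' : ℤ) : ZMod 7) = 0 := by simpa using hr
      rw [ZMod.intCast_zmod_eq_zero_iff_dvd] at h0
      have h7 : Prime (7 : ℤ) := by norm_num
      have hM2 : (7 : ℤ) ∣ -M ^ 2 := by rw [← hrel]; exact dvd_mul_of_dvd_right (by exact_mod_cast h0) _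
      exact hM7 (h7.dvd_of_dvd_pow (dvd_neg.mp hM2))
    refine ⟨(M : ZMod 7) / r, ?_⟩
    rw [hr] at hrel'
    push_cast
    field_simp
    linear_combination -hrel'
  exact not_isSoluble_padic_of_dvd_of_not_isSquare (p := 7) (c := -6 * M) (d₂ := d₂) (by ring) rfl
    (by exact_mod_cast h7d) hns' (hpadic 7)

end Seven


end Summit.BirchSwinnertonDyer.BirchSwinnertonDyer.Theorems.GoldfeldGoodTwists

end
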